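import Summits.ValiantsHypothesis.ValiantsHypothesis.Theorems.BarrierLeverChowHitsPartitionMinorsRStarvedDet

/-!
# Route BarrierLever — item `ChowHitsPartitionMinorsR` (stmt-ValiantsHypothesis-21882), STARVED DESIGN VII:
# the vanishing / pivot table of the row-reduced polynomials (all column types)

Helper file (`--supports stmt-ValiantsHypothesis-21882`; cell valiant-natproofs, rung V4, 𝒟-side; prover seat val-np-p5
gen 31). Closes NO item. Seventh file of the kernel chain for THEOREM A′ of memo MEMO-21882-valnp5-g31.md §3/§5
(K-A3b-4(A)): the entries of the row-reduced matrix `[coeff_{W} pPoly U]` needed by the rank-triangular assembly, under the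
STARVED hypotheses (`α j, β j ∈ O`; the 3-columns avoid `O`):
* products at O–O pair columns (`coeff_rr_mul_rr_pairO`: `[y ∈ W ∧ W ∖ y = {x}]`) and at mixed pair columns `{t′, a′}`
  (`coeff_rr_mul_rr_mixed`);
* the non-edge rows vanish at mixed pair columns (`coeff_pNE_mixed`, the second cancellation), at O–O pair columns
  (`coeff_pNE_pairO`) and at columns of size `≤ 1` inside `O` (`coeff_pNE_small`);
* K–K rows vanish at 3-columns (`coeff_rr_mul_rr_three_K`).
Together with `coeff_pNE_triple` (p725958), `coeff_rr(_single/_two/_three)` (p725534) this is the complete V/D table of memo §5(C).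

WHAT THIS IS NOT: the assembly (pivot bijection, span transfer) is the sequel; nothing on crux stmt-ValiantsHypothesis-14610 or
on `VP` versus `VNP`.
-/

set_option linter.dupNamespace false

namespace Summit.ValiantsHypothesis.ValiantsHypothesis.Theorems.BarrierLever.ChowStarvedDesign

open Finset MvPolynomial

noncomputable section

variable {h r : ℕ}

section Facts

variable (w : Fin r → Finset (Fin h)) (O : Finset (Fin h)) (α β : {j : Fin r // (w j).card = 3} → Fin h)
  (hα : ∀ j, α j ∈ O) (hβ : ∀ j, β j ∈ O) (hK : ∀ j : {j : Fin r // (w j).card = 3}, ∀ c ∈ w j.1, c ∉ O)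

/-- Products at a pair column with vanishing incidences: `[y ∈ W ∧ W ∖ y = {x}]`. -/
theorem coeff_rr_mul_rr_pair_of_inc_zero (x y : Fin h) (W : Finset (Fin h)) (hW : W.card = 2)
    (h1 : ∀ c ∈ W, inc w α β x (W.erase c) = 0) (h2 : ∀ c ∈ W, inc w α β y {c} = 0) :
    coeff (∑ a' ∈ (∅ : Finset (Fin h)), Finsupp.single (Fin.castAdd h a') 1 +
        ∑ c ∈ W, Finsupp.single (Fin.natAdd h c) 1) (rr w α β x * rr w α β y) =
      if y ∈ W ∧ W.erase y = {x} then 1 else 0 := by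
  rw [coeff_rr_mul_rr_two w α β x y W hW]
  have hterm : ∀ c ∈ W, ((if W.erase c = {x} then 1 else 0) + (inc w α β x (W.erase c) : ℂ)) *
      ((if c = y then 1 else 0) + (inc w α β y {c} : ℂ)) = if c = y then (if W.erase y = {x} then 1 else 0) else 0 := by
    intro c hc
    rw [h1 c hc, h2 c hc]
    by_cases hcy : c = y
    · subst hcy; simp
    · rw [if_neg hcy, if_neg hcy]; simp
  rw [Finset.sum_congr rfl hterm, Finset.sum_ite_eq' W y]
  by_cases hy : y ∈ W
  · rw [if_pos hy]
    by_cases he : W.erase y = {x}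
    · rw [if_pos he, if_pos ⟨hy, he⟩]
    · rw [if_neg he, if_neg (fun hh => he hh.2)]
  · rw [if_neg hy, if_neg (fun hh => hy hh.1)]

include hK in
/-- **O–O pair columns**: for `W ⊆ O` of size `2`, `coeff (E ∅ W) (rr x · rr y) = [y ∈ W ∧ W ∖ y = {x}]`. -/
theorem coeff_rr_mul_rr_pairO (x y : Fin h) (W : Finset (Fin h)) (hW : W.card = 2) (hWO : ∀ c ∈ W, c ∈ O) :
    coeff (∑ a' ∈ (∅ : Finset (Fin h)), Finsupp.single (Fin.castAdd h a') 1 +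
        ∑ c ∈ W, Finsupp.single (Fin.natAdd h c) 1) (rr w α β x * rr w α β y) =
      if y ∈ W ∧ W.erase y = {x} then 1 else 0 := by
  refine coeff_rr_mul_rr_pair_of_inc_zero w α β x y W hW (fun c hc => ?_) (fun c hc => ?_)
  · -- `W.erase c` contains the other element of `W`, which lies in `O`
    have hne : (W.erase c).Nonempty := by
      rw [← Finset.card_pos, Finset.card_erase_of_mem hc]; omega
    obtain ⟨c', hc'⟩ := hne
    exact inc_eq_zero_of_mem w O α β hK (hWO c' (Finset.mem_of_mem_erase hc')) hc' x
  · exact inc_eq_zero_of_mem w O α β hK (hWO c hc) (Finset.mem_singleton_self c) y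

include hα hβ in
/-- **K–K rows at any pair column**: for `x, y ∉ O`, `coeff (E ∅ W) (rr x · rr y) = [y ∈ W ∧ W ∖ y = {x}]`. -/
theorem coeff_rr_mul_rr_pairK (x y : Fin h) (hx : x ∉ O) (hy : y ∉ O) (W : Finset (Fin h)) (hW : W.card = 2) :
    coeff (∑ a' ∈ (∅ : Finset (Fin h)), Finsupp.single (Fin.castAdd h a') 1 +
        ∑ c ∈ W, Finsupp.single (Fin.natAdd h c) 1) (rr w α β x * rr w α β y) =
      if y ∈ W ∧ W.erase y = {x} then 1 else 0 :=
  coeff_rr_mul_rr_pair_of_inc_zero w α β x y W hW (fun _ _ => inc_eq_zero_of_not_mem w O α β hα hβ hx _)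
    (fun _ _ => inc_eq_zero_of_not_mem w O α β hα hβ hy _)

include hα hβ in
/-- **K–K rows at 3-columns**: for `x, y ∉ O` and `|W| = 3`, `coeff (E ∅ W) (rr x · rr y) = 0`. -/
theorem coeff_rr_mul_rr_threeK (x y : Fin h) (hx : x ∉ O) (hy : y ∉ O) (W : Finset (Fin h)) (hW : W.card = 3) :
    coeff (∑ a' ∈ (∅ : Finset (Fin h)), Finsupp.single (Fin.castAdd h a') 1 +
        ∑ c ∈ W, Finsupp.single (Fin.natAdd h c) 1) (rr w α β x * rr w α β y) = 0 := by
  rw [coeff_rr_mul_rr_three w α β x y W hW]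
  refine Finset.sum_eq_zero fun c _ => ?_
  simp [inc_eq_zero_of_not_mem w O α β hα hβ hx, inc_eq_zero_of_not_mem w O α β hα hβ hy]

include hK in
/-- **Mixed pair columns** `W = {t′, a′}` (`a′ ∈ O`, `t′ ≠ a′`):
`coeff (E ∅ W) (rr x · rr y) = [x = a′]([y = t′] + inc y {t′}) + ([x = t′] + inc x {t′})[y = a′]`. -/
theorem coeff_rr_mul_rr_mixed (x y t' a' : Fin h) (hta : t' ≠ a') (ha' : a' ∈ O) :
    coeff (∑ c ∈ (∅ : Finset (Fin h)), Finsupp.single (Fin.castAdd h c) 1 +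
        ∑ c ∈ ({t', a'} : Finset (Fin h)), Finsupp.single (Fin.natAdd h c) 1) (rr w α β x * rr w α β y) =
      (if a' = x then 1 else 0) * ((if t' = y then 1 else 0) + (inc w α β y {t'} : ℂ)) +
        ((if t' = x then 1 else 0) + (inc w α β x {t'} : ℂ)) * (if a' = y then 1 else 0) := by
  rw [coeff_rr_mul_rr_two w α β x y {t', a'} (Finset.card_pair hta), Finset.sum_pair hta,
    Finset.erase_insert (Finset.notMem_singleton.mpr hta), Finset.erase_insert_of_ne hta, Finset.erase_singleton,
    Finset.insert_empty,
    inc_eq_zero_of_mem w O α β hK ha' (Finset.mem_singleton_self a') x,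
    inc_eq_zero_of_mem w O α β hK ha' (Finset.mem_singleton_self a') y]
  simp only [Finset.singleton_inj, Nat.cast_zero, add_zero]

include hα hβ hK in
/-- **The second cancellation: non-edge rows vanish at mixed pair columns.** -/
theorem coeff_pNE_mixed (j : {j : Fin r // (w j).card = 3}) (t' a' : Fin h) (ht' : t' ∉ O) (ha' : a' ∈ O) :
    coeff (∑ c ∈ (∅ : Finset (Fin h)), Finsupp.single (Fin.castAdd h c) 1 +
        ∑ c ∈ ({t', a'} : Finset (Fin h)), Finsupp.single (Fin.natAdd h c) 1)
        (rr w α β (α j) * rr w α β (β j) + corrNE w α β j) = 0 := by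
  have hta : t' ≠ a' := fun e => ht' (e ▸ ha')
  have hW2 : ({t', a'} : Finset (Fin h)).card = 2 := Finset.card_pair hta
  unfold corrNE
  rw [coeff_add, coeff_sub, coeff_sub, coeff_pivotTerm w j _ (by rw [hW2]; omega), coeff_sum, coeff_sum,
    if_neg (by rw [← Finset.card_pos, hW2]; omega |> fun hh => Finset.nonempty_iff_ne_empty.mp hh),
    if_neg (show ¬ ({t', a'} : Finset (Fin h)).card = 1 by rw [hW2]; omega), if_pos hW2,
    if_neg (fun hsub => hK j a' (hsub (by simp)) ha')]
  simp_rw [coeff_C_mul, coeff_rr_mul_rr_mixed w O α β hK _ _ t' a' hta ha']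
  -- `[t' = α j] = [t' = β j] = 0`
  have e1 : (if t' = β j then (1 : ℂ) else 0) = 0 := if_neg (fun e => ht' (by rw [e]; exact hβ j))
  have e2 : (if t' = α j then (1 : ℂ) else 0) = 0 := if_neg (fun e => ht' (by rw [e]; exact hα j))
  rw [e1, e2]
  -- the weighted sums: `inc b {t} · ([a' = t] …) = 0` and `inc b {t} · inc t {t'} = 0`
  have hvan : ∀ (b : Fin h) (Z q : ℂ), ∀ t : Fin h, (inc w α β b {t} : ℂ) *
      ((if a' = t then 1 else 0) * Z + ((if t' = t then 1 else 0) + (inc w α β t {t'} : ℂ)) * q) =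
      (if t' = t then (inc w α β b {t'} : ℂ) * q else 0) := by
    intro b Z q t
    by_cases htt : t' = t
    · subst htt
      rw [if_pos rfl, inc_eq_zero_of_not_mem w O α β hα hβ ht' {t'}, if_neg (fun e => ht' (by rw [← e]; exact ha'))]
      simp
    · rw [if_neg htt, if_neg htt]
      by_cases htO : t ∈ O
      · rw [inc_eq_zero_of_mem w O α β hK htO (Finset.mem_singleton_self t) b]
        simp
      · rw [inc_eq_zero_of_not_mem w O α β hα hβ htO {t'}, if_neg (fun e => htO (by rw [← e]; exact ha'))]
        simp
  rw [Finset.sum_congr rfl (fun t _ => hvan (β j) _ _ t), Finset.sum_congr rfl (fun t _ => hvan (α j) _ _ t),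
    Finset.sum_ite_eq Finset.univ t', Finset.sum_ite_eq Finset.univ t', if_pos (Finset.mem_univ _),
    if_pos (Finset.mem_univ _)]
  ring

include hα hβ hK in
/-- **Non-edge rows vanish at O–O pair columns** (`W ⊆ O`, `|W| = 2`, `W ≠ {α j, β j}`). -/
theorem coeff_pNE_pairO (j : {j : Fin r // (w j).card = 3}) (W : Finset (Fin h)) (hW : W.card = 2)
    (hWO : ∀ c ∈ W, c ∈ O) (hWne : W ≠ {α j, β j}) :
    coeff (∑ c ∈ (∅ : Finset (Fin h)), Finsupp.single (Fin.castAdd h c) 1 +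
        ∑ c ∈ W, Finsupp.single (Fin.natAdd h c) 1) (rr w α β (α j) * rr w α β (β j) + corrNE w α β j) = 0 := by
  obtain ⟨c₀, hc₀⟩ : W.Nonempty := by rw [← Finset.card_pos, hW]; omega
  unfold corrNE
  rw [coeff_add, coeff_sub, coeff_sub, coeff_pivotTerm w j W (by omega), coeff_sum, coeff_sum,
    if_neg (Finset.nonempty_iff_ne_empty.mp ⟨c₀, hc₀⟩), if_neg (show ¬ W.card = 1 by omega), if_pos hW,
    if_neg (fun hsub => hK j c₀ (hsub hc₀) (hWO c₀ hc₀)), coeff_rr_mul_rr_pairO w O α β hK _ _ W hW hWO,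
    if_neg (fun hh => hWne ?_)]
  · simp_rw [coeff_C_mul, coeff_rr_mul_rr_pairO w O α β hK _ _ W hW hWO]
    have hz : ∀ (a b t : Fin h), a ∈ O → (inc w α β b {t} : ℂ) * (if a ∈ W ∧ W.erase a = {t} then 1 else 0) = 0 := by
      intro a b t ha
      by_cases hc : a ∈ W ∧ W.erase a = {t}
      · have ht : t ∈ W.erase a := by rw [hc.2]; exact Finset.mem_singleton_self t
        rw [inc_eq_zero_of_mem w O α β hK (hWO t (Finset.mem_of_mem_erase ht)) (Finset.mem_singleton_self t) b]
        simp
      · rw [if_neg hc, mul_zero]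
    rw [Finset.sum_eq_zero (fun t _ => hz (α j) (β j) t (hα j)), Finset.sum_eq_zero (fun t _ => hz (β j) (α j) t (hβ j))]
    ring
  · rw [← Finset.insert_erase hh.1, hh.2, Finset.pair_comm]

end Facts

end

end Summit.ValiantsHypothesis.ValiantsHypothesis.Theorems.BarrierLever.ChowStarvedDesign
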